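import Summits.BirchSwinnertonDyer.BirchSwinnertonDyer.Theorems.UniversalToricDescentResidualCountNoL
import Summits.BirchSwinnertonDyer.BirchSwinnertonDyer.Theorems.UniversalToricDescentDefectTransportResidue
import Summits.BirchSwinnertonDyer.BirchSwinnertonDyer.Theorems.PotentiallySupersingularLocalTowerTorsionFinite
import Literature.NumberTheory.EllipticCurves.Serre1967.PotentiallySupersingularNoStableLineProofs
import Literature.NumberTheory.EllipticCurves.AnticyclotomicPrimeDecompositionAboveProofs
import Literature.NumberTheory.Automorphic.JacquetLanglandsParts
import HarnessLib

/-!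
# Route UniversalToricDescent — stub B′ `stub_lambdaTransportPT` of ♭T′ WITHOUT (iv): the algebraic half of the defect
# transport from the wall + the twin's base finiteness + the twin's local tower torsion finiteness at the strict place

Lead prover bsd-wall-utd-p1 g13 (`--supports` ♭T′ stmt-BirchSwinnertonDyer-26975; memo RESIDUE-B-PRIME-utdp1g13 §3). The FRAME
(`…DefectTransportResidue.defectTransport_algebraicHalf_lambda_of_wall_of_residualComparison`) reduced stub B′, given the
twin's base finiteness, to the residual comparison (M1) `#Sel_{𝔭′}^Σ(K_∞, E[3^∞])[3] = #Sel_{𝔭′}^Σ(K_∞, E′[3^∞])[3]`, whose tree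
proof needed (L) ⟸ (iv) `E(ℚ₃)[3] = 0` (false on 206 habitat classes). `…ResidualCountNoL` proves (M1) WITHOUT (L); this
file instantiates it on the route:

* §1 `fixedPoints_kerD_eq` — bookkeeping `E[p^∞]^{kerD κ v} = E[p^∞]^{D_v ⊓ ker κ}` (the tree's `LocalTowerTorsionFiniteAt` shape);
* §2 `natCard_selmerAc_pTorsion_baseChange_eq_of_modPCongruent_noL` — (M1) for `W, W′/ℚ` with `W′[p] ≅ W[p]`, `ρ̄_{W,p}` onto,
  over an imaginary quadratic `K` with `p` split (`p` odd), an ANTICYCLOTOMIC `ℤ_p`-extension (Brink: `𝔭` finitely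
  decomposed), from Poitou–Tate ×2, `Sel_v(K, ·[p^∞]) < ∞` at both `v ∣ p` for BOTH curves, `Sel_𝔭^Σ(K_∞, W_K[p^∞])[p]` finite,
  and `LocalTowerTorsionFiniteAt` at `𝔭` for both curves — NO (iv);
* §3 **`defectTransport_algebraicHalf_lambda_of_wall_of_twinBaseFinite`** — stub B′'s conclusion VERBATIM from B′'s
  hypotheses + `Sel_v(K, E′[3^∞]) < ∞` at `v ∣ 3` + `LocalTowerTorsionFiniteAt (E′_K) 3 κ 𝔭′`; the wild curve's local tower
  torsion finiteness is the tree theorem `localTowerTorsionFiniteClaim_three_of_classO6` (Serre 1967 Prop. 8, proved).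

So p610218's hypothesis (iv) is RETIRED from stub B′ entirely; what remains of B′ beyond its own binders is the TWIN's base
finiteness (false for twins of `K`-rank ≥ 2: Greenberg–Vatsal Prop. 2.1/2.5 over the tower would be needed) and the twin's
local tower torsion finiteness at `𝔭′` (ordinary / multiplicative / supersingular line analysis; automatic on the 1 817
(iv)-classes). THEOREMS ONLY; no definition, no named fact, no `sorry`; CONDITIONAL on the cited Poitou–Tate facts.
BSD is not advanced by this file. References: [GreenbergVatsal2000] Thm. (1.4), §2; [GreenbergLNM1716] §3–§5; [Brink2007] Cor. 1;
[Serre1967GroupesPDivisibles] §5 Prop. 8.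
-/

set_option autoImplicit false
-- `…BirchSwinnertonDyer.BirchSwinnertonDyer.Theorems…` is the problem's mandated namespace (D-0017).
set_option linter.dupNamespace false

noncomputable section

open scoped Classical

namespace Summit.BirchSwinnertonDyer.BirchSwinnertonDyer.Theorems.UniversalToricDescentDefectTransport

open Function Field NumberField IsDedekindDomain WeierstrassCurve
open Literature.NumberTheory.GaloisRepresentations Literature.NumberTheory.EllipticCurves
  Literature.NumberTheory.EllipticCurves.GreenbergSelmer Literature.NumberTheory.GaloisCohomology
  Literature.NumberTheory.EllipticCurves.IwasawaAlgebra Literature.NumberTheory.EllipticCurves.Rank1Residual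
  Summit.BirchSwinnertonDyer.Rank1Residual Summit.BirchSwinnertonDyer.Rank1Residual.X11b
  Summit.BirchSwinnertonDyer.Rank1Residual.X11b.Coinv Summit.BirchSwinnertonDyer.Rank1Residual.X11b.AcSelmer
  Summit.BirchSwinnertonDyer.Rank1Residual.X11b.LocBridge Summit.BirchSwinnertonDyer.Rank1Residual.Iwasawa
  Summit.BirchSwinnertonDyer.BirchSwinnertonDyer.Theorems.UniversalToricDescentSigmaPassage
  Summit.BirchSwinnertonDyer.BirchSwinnertonDyer.Theorems.UniversalToricDescentSigmaLocalImage
  Summit.BirchSwinnertonDyer.BirchSwinnertonDyer.Theorems.UniversalToricDescentSigmaLocalStabilizer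
  Summit.BirchSwinnertonDyer.BirchSwinnertonDyer.Theorems.UniversalToricDescentSigmaCoinvariants
  Summit.BirchSwinnertonDyer.BirchSwinnertonDyer.Theorems.UniversalToricDescentAcDualMuZero
  Summit.BirchSwinnertonDyer.BirchSwinnertonDyer.Theorems.UniversalToricDescentTorsionMuTransportHeegner
  Summit.BirchSwinnertonDyer.BirchSwinnertonDyer.Theorems.UniversalToricDescentStrictPlaceTuple
  Summit.BirchSwinnertonDyer.BirchSwinnertonDyer.Theorems.UniversalToricDescentResidualSelmer
  Summit.BirchSwinnertonDyer.BirchSwinnertonDyer.Theorems.SchneiderFreeAdditiveX3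
  Summit.BirchSwinnertonDyer.BirchSwinnertonDyer.Theorems.SchneiderFreeControlAtoms
  Summit.BirchSwinnertonDyer.BirchSwinnertonDyer.Theorems.PotentiallySupersingularLocalTorsion

/-! ### §1 `kerD`-fixed points = `(D_v ⊓ ker κ)`-fixed points -/

/-- The fixed points of `E[p^∞]` under `kerD κ v ≤ D_v` and under `D_v ⊓ ker κ ≤ Γ_K` coincide (same elements of `Γ_K`).
[folklore] -/
theorem fixedPoints_kerD_eq {K : Type} [Field K] [NumberField K] {p : ℕ} [Fact p.Prime] (κ : ZpExtension K p)
    (W : WeierstrassCurve K) (v : HeightOneSpectrum (𝓞 K)) :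
    (FixedPoints.addSubgroup (kerD κ v) (W.geomPrimaryTorsion p) : Set (W.geomPrimaryTorsion p)) =
      FixedPoints.addSubgroup ↥(decomp v ⊓ κ.kerSubgroup) (W.geomPrimaryTorsion p) := by
  ext m
  simp only [SetLike.mem_coe]
  constructor
  · intro hm g
    have hg := Subgroup.mem_inf.mp g.2
    have h := hm ⟨⟨(g : absoluteGaloisGroup K), hg.1⟩, (mem_kerD_iff κ v _).2 hg.2⟩
    exact h
  · intro hm g
    have hg : ((g : decomp (K := K) v) : absoluteGaloisGroup K) ∈ decomp v ⊓ κ.kerSubgroup :=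
      Subgroup.mem_inf.mpr ⟨(g : decomp (K := K) v).2, (mem_kerD_iff κ v _).1 g.2⟩
    exact hm ⟨_, hg⟩

/-! ### §2 (M1) WITHOUT (L) on the route -/

/-- **`#Sel_𝔭^Σ(K_∞, W_K[p^∞])[p] = #Sel_𝔭^Σ(K_∞, W′_K[p^∞])[p]` WITHOUT (iv)/(L)** for `W, W′/ℚ` with `W′[p] ≅ W[p]`
(`ModPCongruent W′ W p`), `ρ̄_{W,p}` onto (so `W(K_∞)[p] = 0`), `p` odd, `K` imaginary quadratic with `p` split, an
anticyclotomic `ℤ_p`-extension `κ` with topological generator `γ`, `𝔭 ∋ p` the strict place, a finite `Σ ∌ (v ∣ p)` containing the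
bad places of `W_K`, `W′_K` prime to `p`; GIVEN Poitou–Tate ×2, `Sel_v(K, ·[p^∞]) < ∞` at both `v ∣ p` for BOTH curves,
`Sel_𝔭^Σ(K_∞, W_K[p^∞])[p]` finite, and the local tower torsion finiteness at `𝔭` for both curves.
[cite: GreenbergVatsal2000, §2 Prop. (2.1), (2.8) (pp. 23–27)] [cite: Brink2007, Cor. 1] [cite: MilneADT2006, Ch. I, Thm. 4.10] -/
theorem natCard_selmerAc_pTorsion_baseChange_eq_of_modPCongruent_noL (W W' : WeierstrassCurve ℚ) [W.IsElliptic]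
    [W.IsGloballyMinimal] [W'.IsElliptic] [W'.IsGloballyMinimal] (p : ℕ) [Fact p.Prime] (hp2 : p ≠ 2)
    {K : Type} [Field K] [NumberField K] (hK : IsImaginaryQuadratic K) (hsplit : SplitsIn K p)
    (hPT : poitouTate_selmerStructure_duality K) (hPT2 : poitouTate_sha_tateDual K)
    (κ : ZpExtension K p) (hκ : κ.IsAnticyclotomic) {γ : absoluteGaloisGroup K} (hγ : κ.IsTopGenerator γ)
    {𝔭 : HeightOneSpectrum (𝓞 K)} (h𝔭 : ((p : ℕ) : 𝓞 K) ∈ 𝔭.asIdeal)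
    (hsurj : W.HasSurjectiveModNGaloisRep (p : ℤ)) (hcong : O6.ModPCongruent W' W p)
    {S : Set (HeightOneSpectrum (𝓞 K))} (hS : S.Finite)
    (hSW : ∀ v : HeightOneSpectrum (𝓞 K), v ∉ S → ((p : ℕ) : 𝓞 K) ∉ v.asIdeal →
      (W.baseChange K).HasGoodReductionAt v)
    (hSW' : ∀ v : HeightOneSpectrum (𝓞 K), v ∉ S → ((p : ℕ) : 𝓞 K) ∉ v.asIdeal →
      (W'.baseChange K).HasGoodReductionAt v)
    (hfin : ∀ v : HeightOneSpectrum (𝓞 K), ((p : ℕ) : 𝓞 K) ∈ v.asIdeal →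
      Finite (selmerAcBase (W.baseChange K) p v ∅))
    (hfin' : ∀ v : HeightOneSpectrum (𝓞 K), ((p : ℕ) : 𝓞 K) ∈ v.asIdeal →
      Finite (selmerAcBase (W'.baseChange K) p v ∅))
    (hfinS : Set.Finite {s : selmerAc (W.baseChange K) p κ 𝔭 S | p • s = 0})
    (hδ : LocalTowerTorsionFiniteAt (W.baseChange K) p κ 𝔭)
    (hδ' : LocalTowerTorsionFiniteAt (W'.baseChange K) p κ 𝔭) :
    Nat.card {s : selmerAc (W.baseChange K) p κ 𝔭 S // p • s = 0} =
      Nat.card {s : selmerAc (W'.baseChange K) p κ 𝔭 S // p • s = 0} := by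
  haveI : IsTotallyComplex K := hK.2
  haveI hEK : (W.baseChange K).IsElliptic := by rw [WeierstrassCurve.baseChange]; infer_instance
  haveI hEK' : (W'.baseChange K).IsElliptic := by rw [WeierstrassCurve.baseChange]; infer_instance
  -- the conjugate prime `𝔮` (degree one) and the killing exponents there
  obtain ⟨σ, 𝔮, -, hne, h𝔮, -⟩ :=
    LocalIndexTransport.exists_conj_prime_of_splitsIn K p hK.1 hsplit h𝔭
  obtain ⟨he𝔮, hf𝔮⟩ := degreeOne_of_splitsIn hK.1 hsplit h𝔮
  obtain ⟨m₁, hm₁⟩ := exists_pow_nsmul_fixedPoints_decomp_eq_zero W p 𝔮 h𝔮 he𝔮 hf𝔮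
  obtain ⟨m₂, hm₂⟩ := exists_pow_nsmul_fixedPoints_decomp_eq_zero W' p 𝔮 h𝔮 he𝔮 hf𝔮
  -- `H²(K, ·[p^∞]) = 0` for both curves
  have htor := exists_pow_nsmul_local_eq_zero W p hK.1 hsplit
  have htor' := exists_pow_nsmul_local_eq_zero W' p hK.1 hsplit
  haveI := hfin 𝔭 h𝔭
  haveI := hfin' 𝔭 h𝔭
  have h2 := subsingleton_galoisCohomology_two_primary_anyTorsion (W.baseChange K) p 𝔭 ∅ hPT2
    (fieldCdLE_two_of_isTotallyComplex fieldCdLE_two_of_numberField_holds K p) htor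
  have h2' := subsingleton_galoisCohomology_two_primary_anyTorsion (W'.baseChange K) p 𝔭 ∅ hPT2
    (fieldCdLE_two_of_isTotallyComplex fieldCdLE_two_of_numberField_holds K p) htor'
  -- `𝔭` is finitely decomposed (Brink) with exact index `p^c`
  have hv : ¬ (decomp 𝔭 ≤ κ.kerSubgroup) :=
    ZpExtension.decomp_not_le_kerSubgroup_above_of_isAnticyclotomic_holds K p hK hp2 κ hκ 𝔭 h𝔭
  obtain ⟨c, -, hc, hle⟩ := exists_pow_and_forall_dvd_of_not_le κ 𝔭 hv
  -- a fake strict place `v₀ ∤ p` outside `Σ`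
  haveI : Infinite (HeightOneSpectrum (𝓞 K)) := Literature.NumberTheory.Automorphic.infinite_heightOneSpectrum K
  have hp0 : p ≠ 0 := (Fact.out : p.Prime).ne_zero
  obtain ⟨v₀, hv₀⟩ := ((hS.union (H2Support.finite_setOf_natCast_mem (K := K) p hp0)).infinite_compl).nonempty
  have hv₀S : v₀ ∉ S := fun h ↦ hv₀ (Or.inl h)
  have hv₀p : ((p : ℕ) : 𝓞 K) ∉ v₀.asIdeal := fun h ↦ hv₀ (Or.inr h)
  -- `W(K_∞)[p] = 0`, the torsion isomorphism
  have hG : ∀ m : (W.baseChange K).geomPrimaryTorsion p, (∀ σ ∈ κ.kerSubgroup, σ • m = m) → p • m = 0 → m = 0 := by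
    intro m hm _
    have hmem : m ∈ FixedPoints.addSubgroup κ.kerSubgroup (geomPrimaryTorsion (W.baseChange K) p) := fun g ↦ hm g g.2
    rw [UniversalToricDescentTowerTorsion.fixedPoints_kerSubgroup_geomPrimaryTorsion_baseChange_eq_bot_of_surjective W p
      hsurj K hK κ] at hmem
    exact (AddSubgroup.mem_bot).mp hmem
  obtain ⟨e, he⟩ := UniversalToricDescentResidualSelmerTransfer.exists_torsionIso_baseChange_of_modPCongruent (K := K) W W' hcong
  have hes : ∀ (σ : absoluteGaloisGroup K) (P : (W.baseChange K).geomTorsion (p : ℤ)),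
      e.symm (σ • P) = σ • e.symm P := fun σ P ↦ by
    apply e.injective; rw [e.apply_symm_apply, he, e.apply_symm_apply]
  -- divisibility: `Sel = p·Sel` for both (for the twin from the finiteness the count provides)
  have hEP : ∀ v : HeightOneSpectrum (𝓞 K), localEulerPoincareCharacteristic (v.adicCompletion K) :=
    fun v ↦ GaloisImage.EP.localEulerPoincareCharacteristic_adicCompletion K v
  have hdiv : ∀ s ∈ selmerAc (W.baseChange K) p κ 𝔭 S, ∃ s' ∈ selmerAc (W.baseChange K) p κ 𝔭 S, p • s' = s :=
    selmerAc_divisible_of_finite_pTorsion_anyTorsion (W.baseChange K) p κ hPT hEP h𝔭 h𝔮 hne hm₁ (hfin 𝔮 h𝔮) h2 γ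
      (hγ := ⟨hγ⟩) hS hfinS
  have hdiv' : Set.Finite {s : selmerAc (W'.baseChange K) p κ 𝔭 S | p • s = 0} →
      ∀ s ∈ selmerAc (W'.baseChange K) p κ 𝔭 S, ∃ s' ∈ selmerAc (W'.baseChange K) p κ 𝔭 S, p • s' = s :=
    fun hfinS' ↦ selmerAc_divisible_of_finite_pTorsion_anyTorsion (W'.baseChange K) p κ hPT hEP h𝔭 h𝔮 hne hm₂
      (hfin' 𝔮 h𝔮) h2' γ (hγ := ⟨hγ⟩) hS hfinS'
  -- local tower torsion finiteness in the `kerD` shape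
  have hδ₁ : (FixedPoints.addSubgroup (kerD κ 𝔭) ((W.baseChange K).geomPrimaryTorsion p) :
      Set ((W.baseChange K).geomPrimaryTorsion p)).Finite := by
    rw [fixedPoints_kerD_eq]; exact hδ
  have hδ₂ : (FixedPoints.addSubgroup (kerD κ 𝔭) ((W'.baseChange K).geomPrimaryTorsion p) :
      Set ((W'.baseChange K).geomPrimaryTorsion p)).Finite := by
    rw [fixedPoints_kerD_eq]; exact hδ'
  -- the (L)-free comparison along `e⁻¹ : W_K[p] ≅ W′_K[p]`
  exact natCard_selmerAc_pTorsion_eq_of_torsionIso_noL κ (W.baseChange K) (W'.baseChange K) hPT hEP h𝔭 h𝔮 hne hm₁ hm₂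
    (hfin 𝔮 h𝔮) (hfin' 𝔮 h𝔮) h2 h2' hγ hSW hSW' hv₀p hv₀S hc hle e.symm hes hG hdiv hfinS hdiv' hδ₁ hδ₂

/-! ### §3 Stub B′ from the wall + the twin's base finiteness + the twin's local tower torsion finiteness — NO (iv) -/

/-- **Stub B′'s conclusion VERBATIM from B′'s hypotheses + `Sel_v(K, E′[3^∞]) < ∞` at `v ∣ 3` + finiteness of
`E′(K_{∞,𝔭′})[3^∞]`** — p610218's hypothesis (iv) `E(ℚ₃)[3] = 0` is RETIRED (all 2 023 habitat classes): the residual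
comparison (M1) comes from `natCard_selmerAc_pTorsion_baseChange_eq_of_modPCongruent_noL`, the wild curve's local tower torsion
finiteness from Serre 1967 Prop. 8 on the O6 class (`localTowerTorsionFiniteClaim_three_of_classO6`, proved in the tree), the rest
is the FRAME `defectTransport_algebraicHalf_lambda_of_wall_of_residualComparison`.
[cite: GreenbergVatsal2000, Thm. (1.4), §2 Prop. (2.1), (2.4), (2.8), (2.10) (pp. 23–28)] [cite: Serre1967GroupesPDivisibles, §5 Prop. 8]
[cite: Brink2007, Thm. 2 and Cor. 1] [cite: MilneADT2006, Ch. I, Thm. 4.10] -/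
theorem defectTransport_algebraicHalf_lambda_of_wall_of_twinBaseFinite (W W' : WeierstrassCurve ℚ)
    [W.IsElliptic] [W.IsGloballyMinimal] [W'.IsElliptic] [W'.IsGloballyMinimal] {N N' : ℕ} (K : Type) [Field K]
    [NumberField K]
    (hO6 : Additive.ClassO6 W 3) (hsurj : W.HasSurjectiveModNGaloisRep 3) (hN : W.conductorNorm ℤ = N)
    (hcong : O6.ModPCongruent W' W 3) (hN' : W'.conductorNorm ℤ = N') (hK : IsImaginaryQuadratic K)
    (hHe : SatisfiesHeegnerHypothesis N K) (hHe' : SatisfiesHeegnerHypothesis N' K)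
    (κ : ZpExtension K 3) (hκ : κ.IsAnticyclotomic) (γ : absoluteGaloisGroup K)
    [Fact (κ.IsTopGenerator γ)] {𝔭' : HeightOneSpectrum (𝓞 K)} (h𝔭' : ((3 : ℕ) : 𝓞 K) ∈ 𝔭'.asIdeal)
    (hT : Module.IsTorsion (IwasawaAlgebra 3) (XAc (W.baseChange K) 3 κ 𝔭' ∅ γ))
    {L : UnrSeries 3}
    (hle : Ideal.span {L} ≤
      (XAc.charIdeal (W.baseChange K) 3 κ 𝔭' ∅ γ).map (PowerSeries.map (Halves.toUnr 3)))
    (hi : ∃ i : ℕ, ‖((PowerSeries.coeff i L : unrIntegers 3) : ℂ_[3])‖ = 1)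
    (hPT : poitouTate_selmerStructure_duality K) (hPT2 : poitouTate_sha_tateDual K)
    (hfin : ∀ v : HeightOneSpectrum (𝓞 K), ((3 : ℕ) : 𝓞 K) ∈ v.asIdeal →
      Finite (selmerAcBase (W.baseChange K) 3 v ∅))
    (hfin' : ∀ v : HeightOneSpectrum (𝓞 K), ((3 : ℕ) : 𝓞 K) ∈ v.asIdeal →
      Finite (selmerAcBase (W'.baseChange K) 3 v ∅))
    (hδ' : LocalTowerTorsionFiniteAt (W'.baseChange K) 3 κ 𝔭') :
    ∃ (T : Finset (HeightOneSpectrum (𝓞 K))) (c s s' : HeightOneSpectrum (𝓞 K) → ℕ),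
      (↑T = {v : HeightOneSpectrum (𝓞 K) | ((3 : ℕ) : 𝓞 K) ∉ v.asIdeal ∧
        (¬ (W.baseChange K).HasGoodReductionAt v ∨ ¬ (W'.baseChange K).HasGoodReductionAt v)}) ∧
      (∀ v ∈ T, (∃ d₀ : decomp (K := K) v, (κ (d₀ : absoluteGaloisGroup K)).toAdd = (3 : ℤ_[3]) ^ c v) ∧
        (∀ d : decomp (K := K) v, (3 : ℤ_[3]) ^ c v ∣ (κ (d : absoluteGaloisGroup K)).toAdd) ∧
        Nat.card {f : subgroupH1 (kerD κ v) ((W.baseChange K).geomPrimaryTorsion 3) // 3 • f = 0} =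
          3 ^ s v ∧
        Nat.card {f : subgroupH1 (kerD κ v) ((W'.baseChange K).geomPrimaryTorsion 3) // 3 • f = 0} =
          3 ^ s' v) ∧
      (∃ g : UnrSeries 3,
        (XAc.charIdeal (W.baseChange K) 3 κ 𝔭' ∅ γ).map (PowerSeries.map (Halves.toUnr 3)) =
            Ideal.span {g} ∧
          (∀ i < lambdaInvariant 3 (XAc (W.baseChange K) 3 κ 𝔭' ∅ γ),
            ‖((PowerSeries.coeff i g : unrIntegers 3) : ℂ_[3])‖ < 1) ∧
          ‖((PowerSeries.coeff (lambdaInvariant 3 (XAc (W.baseChange K) 3 κ 𝔭' ∅ γ)) g :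
            unrIntegers 3) : ℂ_[3])‖ = 1) ∧
      Module.IsTorsion (IwasawaAlgebra 3) (XAc (W'.baseChange K) 3 κ 𝔭' ∅ γ) ∧
      (∃ g' : UnrSeries 3,
        (XAc.charIdeal (W'.baseChange K) 3 κ 𝔭' ∅ γ).map (PowerSeries.map (Halves.toUnr 3)) =
            Ideal.span {g'} ∧
          (∀ i < lambdaInvariant 3 (XAc (W'.baseChange K) 3 κ 𝔭' ∅ γ),
            ‖((PowerSeries.coeff i g' : unrIntegers 3) : ℂ_[3])‖ < 1) ∧
          ‖((PowerSeries.coeff (lambdaInvariant 3 (XAc (W'.baseChange K) 3 κ 𝔭' ∅ γ)) g' :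
            unrIntegers 3) : ℂ_[3])‖ = 1) ∧
      lambdaInvariant 3 (XAc (W.baseChange K) 3 κ 𝔭' ∅ γ) + ∑ v ∈ T, 3 ^ c v * s v =
        lambdaInvariant 3 (XAc (W'.baseChange K) 3 κ 𝔭' ∅ γ) + ∑ v ∈ T, 3 ^ c v * s' v  := by
  haveI : Fact (Nat.Prime 3) := ⟨Nat.prime_three⟩
  -- the bad set `Σ`
  set S : Set (HeightOneSpectrum (𝓞 K)) := {v | ((3 : ℕ) : 𝓞 K) ∉ v.asIdeal ∧
    (¬ (W.baseChange K).HasGoodReductionAt v ∨ ¬ (W'.baseChange K).HasGoodReductionAt v)} with hSdef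
  have hSfin : S.Finite := by
    refine (((W.baseChange K).finite_badPlaces_holds (𝓞 K)).union
      ((W'.baseChange K).finite_badPlaces_holds (𝓞 K))).subset fun v hv ↦ ?_
    rcases hv.2 with h | h
    · exact Or.inl h
    · exact Or.inr h
  have hSp : ∀ v ∈ S, ((3 : ℕ) : 𝓞 K) ∉ v.asIdeal := fun v hv ↦ hv.1
  have hSdec : ∀ v ∈ S, ¬ (decomp v ≤ κ.kerSubgroup) := by
    intro v hv
    rcases hv.2 with h | h
    · exact not_decomp_le_kerSubgroup_of_not_hasGoodReductionAt_baseChange W hN K hK hHe (by decide) κ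
        hκ hv.1 h
    · exact not_decomp_le_kerSubgroup_of_not_hasGoodReductionAt_baseChange W' hN' K hK hHe' (by decide)
        κ hκ hv.1 h
  have hgood : ∀ v : HeightOneSpectrum (𝓞 K), v ∉ S → ((3 : ℕ) : 𝓞 K) ∉ v.asIdeal →
      (W.baseChange K).HasGoodReductionAt v := fun v hv hpv ↦ by
    by_contra h; exact hv ⟨hpv, Or.inl h⟩
  have hgood' : ∀ v : HeightOneSpectrum (𝓞 K), v ∉ S → ((3 : ℕ) : 𝓞 K) ∉ v.asIdeal →
      (W'.baseChange K).HasGoodReductionAt v := fun v hv hpv ↦ by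
    by_contra h; exact hv ⟨hpv, Or.inr h⟩
  -- `3` splits in the Heegner field
  have hadd : Addv W 3 := hO6.2.1
  have hpN : 3 ∣ W.conductorNorm ℤ := (W.dvd_conductorNorm_iff_not_hasGoodReductionAtPrime 3).mpr hadd.1
  have hsplit : SplitsIn K 3 := hHe 3 (Fact.out) (hN ▸ hpN)
  -- `Sel^Σ(E)[3]` is finite: `μ(X_E) = 0` from the wall
  haveI := XAc.module_finite κ 𝔭' (∅ : Set (HeightOneSpectrum (𝓞 K))) γ Set.finite_empty (W := W.baseChange K)
  have hμe : muInvariant 3 (XAc (W.baseChange K) 3 κ 𝔭' ∅ γ) = 0 :=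
    muInvariant_eq_zero_of_span_le_map_charIdeal (XAc (W.baseChange K) 3 κ 𝔭' ∅ γ) hT hle hi
  have hfine : Set.Finite {s : selmerAc (W.baseChange K) 3 κ 𝔭' ∅ | 3 • s = 0} :=
    finite_pTorsion_of_muInvariant_eq_zero (W.baseChange K) 3 κ 𝔭' ∅ γ hT hμe
  have hfinS : Set.Finite {s : selmerAc (W.baseChange K) 3 κ 𝔭' S | 3 • s = 0} :=
    finite_selmerAc_pTorsion_of_empty (W.baseChange K) κ hSfin hSp hSdec hfine
  -- the wild curve's local tower torsion at `𝔭′` is finite (Serre 1967 Prop. 8 on the O6 class)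
  have hδ : LocalTowerTorsionFiniteAt (W.baseChange K) 3 κ 𝔭' :=
    localTowerTorsionFiniteClaim_three_of_classO6 Serre1967.noStableDivisibleLine_of_potentiallySupersingular_holds W
      hO6 K hK hsplit κ hκ 𝔭' h𝔭'
  -- (M1) WITHOUT (L), then the FRAME
  have hcmp := natCard_selmerAc_pTorsion_baseChange_eq_of_modPCongruent_noL W W' 3 (by decide) hK hsplit hPT hPT2 κ hκ
    (γ := γ) Fact.out h𝔭' (by exact_mod_cast hsurj) hcong hSfin hgood hgood' hfin hfin' hfinS hδ hδ'
  exact defectTransport_algebraicHalf_lambda_of_wall_of_residualComparison W W' K hO6 hN hN' hK hHe hHe' κ hκ γ h𝔭'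
    hT hle hi hPT hPT2 hfin hfin' hcmp

end Summit.BirchSwinnertonDyer.BirchSwinnertonDyer.Theorems.UniversalToricDescentDefectTransport

end
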